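import Summits.AtomisticToContinuum.FouriersLaw.Theorems.BoundaryKubo.Negative.LoadBearing
import Summits.AtomisticToContinuum.FouriersLaw.Theorems.BoundaryKubo.Negative.Reflection

/-!
# `BoundaryKubo` — the limit clause is equivalent to its one-sided version (negative-side support)

For crux `PhononMeanFreePath.BoundaryKubo` (stmt-AtomisticToContinuum-11812): combining the
vocabulary of `Negative/LoadBearing.lean` (`UniqueSteady`, `SteadyFamily`, `LimitClause`,
`kuboValue`) with the reflection symmetry of `Negative/Reflection.lean`
(`tendsto_responseQuotient_iff`): under weak-NESS uniqueness the response quotient is even in `δ`,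
so `LimitClause` (limit along `𝓝[≠] 0`) holds iff the one-sided limit `δ → 0⁺` does — provers of
the crux may assume `T_L > T_R`. Sorry-free; nothing closes the item.
-/

noncomputable section

namespace Summit.AtomisticToContinuum.FouriersLaw.Theorems.BoundaryKubo.Negative.OneSided

open MeasureTheory Filter Topology Set
open Literature.MathematicalPhysics.KineticTheory.HeatConduction
open Summit.AtomisticToContinuum.FouriersLaw.Theorems.BoundaryKubo.Negative.LoadBearing
open Summit.AtomisticToContinuum.FouriersLaw.Theorems.BoundaryKubo.Negative.Reflection

/-- **The limit clause is equivalent to its one-sided version** (`δ → 0⁺`): under uniqueness the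
response quotient is even in `δ` (`responseQuotient_neg`), so provers may restrict to `T_L > T_R`.
[folklore] -/
theorem limitClause_iff_tendsto_nhdsGT {ω₂ lam β γ : ℝ} (hU : UniqueSteady ω₂ lam β γ)
    {μ : (M : ℕ) → ℝ → ℝ → Measure (PhaseSpace M)} (hμ : SteadyFamily ω₂ lam β γ μ)
    {T : ℝ} (hT : 0 < T) (N : ℕ) :
    LimitClause ω₂ lam β γ μ T N ↔
      Tendsto (fun δ : ℝ =>
        (pinnedChain ω₂ lam β γ).totalCurrent (μ (N + 1) (T + δ / 2) (T - δ / 2)) / δ)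
        (𝓝[>] 0) (𝓝 (kuboValue ω₂ lam β γ T N)) :=
  tendsto_responseQuotient_iff hU hμ hT (N + 1) _

/-- Consequently the crux itself may be stated with one-sided response limits: an equivalent
reformulation of `BoundaryKubo` (read-back `boundaryKubo_iff` + the previous lemma). [folklore] -/
theorem boundaryKubo_iff_oneSided :
    Summit.AtomisticToContinuum.FouriersLaw.Theses.PhononMeanFreePath.BoundaryKubo ↔
      ∀ ω₂ lam β γ : ℝ, 0 < ω₂ → 0 < lam → 0 < β → 0 < γ →
      UniqueSteady ω₂ lam β γ →
        ∀ μ : (M : ℕ) → ℝ → ℝ → Measure (PhaseSpace M), SteadyFamily ω₂ lam β γ μ →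
          ∀ T : ℝ, 0 < T → ∀ N : ℕ,
            IntegrableOn (kuboIntegrand ω₂ lam β γ T N) (Ioi 0) ∧
              Tendsto (fun δ : ℝ =>
                (pinnedChain ω₂ lam β γ).totalCurrent (μ (N + 1) (T + δ / 2) (T - δ / 2)) / δ)
                (𝓝[>] 0) (𝓝 (kuboValue ω₂ lam β γ T N)) := by
  rw [boundaryKubo_iff]
  refine forall₄_congr fun ω₂ lam β γ => ?_
  refine forall₄_congr fun _ _ _ _ => ?_
  refine forall_congr' fun hU => forall₂_congr fun μ hμ => forall₂_congr fun T hT => ?_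
  refine forall_congr' fun N => ?_
  rw [limitClause_iff_tendsto_nhdsGT hU hμ hT N]

end Summit.AtomisticToContinuum.FouriersLaw.Theorems.BoundaryKubo.Negative.OneSided
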